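import Literature.NumberTheory.Sieve.FriableCellFactorisation
import HarnessLib

/-!
# Cell factorisation of friable squarefree integers, II: existence, uniqueness, class partition

Topic `Literature/NumberTheory/Sieve`; sequel of `FriableCellFactorisation.lean` (definitions
`cell`, `lowPart`, `lowPartLT`, `lowSet`, `highSet`).  Everything PROVED:

* `exists_factorisation` — a squarefree `d` with prime factors `< Y` in cells `≤ K`,
  `A < d ≤ Dn`, no two distinct prime factors in one cell, factors as `d = n · m` with
  `n ∈ lowSet k`, `m ∈ highSet k`, `k ≤ K`, provided `A · Y ≤ N` and `Dn ≤ A · M`;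
* `eq_of_mul_eq_mul` — uniqueness: `n m = n' m'` forces `(k, n, m) = (k', n', m')`;
* `triples`, `injOn_triples`, `image_triples_subset`, `mem_image_triples` — the index set of the
  class decomposition and the bijection onto the good `d`;
* `abs_sum_sub_sum_classes_le` — **the class partition**: for any `F`,
  `|∑_{d ≤ Dn squarefree Y-friable} F(d) − ∑_{k ≤ K} ∑_{n ∈ lowSet k} ∑_{m ∈ highSet k, nm ≤ Dn} F(nm)|`
  is at most `∑_{d ≤ A} |F| + ∑_{d with two prime factors in one cell} |F|`;
* `sum_classes_filter_le` — sub-sums of the class decomposition cut out by a predicate `Q(nm)`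
  are dominated by `∑_{d : Q d} G(d)` (`G ≥ 0`).

This is the combinatorial half of the passage from a BILINEAR level-of-distribution statement
(Iwaniec's Corollary of Proposition 1 for `n² + 1`) to friable moduli
(`IwaniecFriableLevel.lean`).  Device: [cite: Greaves2001, Ch. 6, §6.1 and §6.1.1 Lemma 1]
(condensation of the prime factors into cells); the friable version is folklore.
-/

open Finset Real

noncomputable section

/-! ## Structure theorems: existence and uniqueness of the cell factorisation, the class partition -/

namespace Literature.NumberTheory.Sieve.FriableCell

/-- **Existence of the cell factorisation.**  Let `d` be squarefree, with all prime factors `< Y`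
and in cells `≤ K`, `A < d ≤ Dn`, and suppose no two distinct prime factors of `d` share a cell.
If `A · Y ≤ N` and `Dn ≤ A · M` then `d = n · m` with `n ∈ lowSet k`, `m ∈ highSet k` for some
`k ≤ K` (namely the least `k` with `lowPart k d > A`). [folklore] -/
theorem exists_factorisation {T A : ℝ} (hA : 1 ≤ A) {Y N M Dn K d : ℕ}
    (hAY : A * Y ≤ N) (hDM : (Dn : ℝ) ≤ A * M)
    (hd : Squarefree d) (hdY : ∀ p ∈ d.primeFactors, p < Y)
    (hdK : ∀ p ∈ d.primeFactors, cell T p ≤ K) (hdA : A < (d : ℝ)) (hdD : d ≤ Dn)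
    (hsep : ∀ q ∈ d.primeFactors, ∀ q' ∈ d.primeFactors, cell T q = cell T q' → q = q') :
    ∃ k, k ≤ K ∧ ∃ n ∈ lowSet T A Y N k, ∃ m ∈ highSet T Y M k, n * m = d := by
  classical
  have hdself : lowPart T K d = d := lowPart_eq_self hd hdK
  have hex : ∃ k, A < (lowPart T k d : ℝ) := ⟨K, by rw [hdself]; exact hdA⟩
  obtain ⟨k, hk, hkmin⟩ : ∃ k, A < (lowPart T k d : ℝ) ∧ ∀ k' < k, ¬ A < (lowPart T k' d : ℝ) :=
    ⟨Nat.find hex, Nat.find_spec hex, fun k' h => Nat.find_min hex h⟩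
  have hkK : k ≤ K := by
    by_contra hcon
    exact hkmin K (not_le.mp hcon) (by rw [hdself]; exact hdA)
  -- the strict low part is `≤ A`
  have hLT : (lowPartLT T k d : ℝ) ≤ A := by
    rcases k with _ | k'
    · rw [lowPartLT_zero]; simpa using hA
    · rw [lowPartLT_succ]
      exact not_lt.mp (hkmin k' (Nat.lt_succ_self k'))
  -- `d ≥ 2`, so `Y ≥ 2`
  have hd0 : d ≠ 0 := hd.ne_zero
  have hd2 : 2 ≤ d := by
    have h1 : (1 : ℝ) < d := lt_of_le_of_lt hA hdA
    have : 1 < d := by exact_mod_cast h1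
    omega
  have hY2 : 2 ≤ Y := by
    obtain ⟨p, hp⟩ : d.primeFactors.Nonempty := by
      rw [Finset.nonempty_iff_ne_empty, Ne, Nat.primeFactors_eq_empty]; omega
    have hp2 := (Nat.prime_of_mem_primeFactors hp).two_le
    have := hdY p hp
    omega
  -- the primes of `d` in cell `k`: at most one, product `< Y`
  set C := ∏ p ∈ d.primeFactors.filter (fun p => cell T p = k), p with hC
  have hCn : (lowPartLT T k d) * C = lowPart T k d := lowPartLT_mul_prod_filter k d
  have hCY : (C : ℝ) < Y := by
    set S := d.primeFactors.filter (fun p => cell T p = k) with hS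
    rcases S.eq_empty_or_nonempty with hSe | ⟨p, hp⟩
    · rw [hC, hSe, Finset.prod_empty]; exact_mod_cast (lt_of_lt_of_le one_lt_two hY2)
    · have hsub : S = {p} := by
        refine Finset.eq_singleton_iff_unique_mem.mpr ⟨hp, fun q hq => ?_⟩
        have hq' := Finset.mem_filter.mp hq
        have hp' := Finset.mem_filter.mp hp
        exact hsep q hq'.1 p hp'.1 (hq'.2.trans hp'.2.symm)
      rw [hC, hsub, Finset.prod_singleton]
      exact_mod_cast hdY p (Finset.mem_filter.mp hp).1
  set n := lowPart T k d with hn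
  set m := ∏ p ∈ d.primeFactors.filter (fun p => ¬ cell T p ≤ k), p with hm
  have hnm : n * m = d := lowPart_mul_prod_filter k hd
  have hn0 : 0 < n := lowPart_pos T k d
  have hm0 : 0 < m :=
    Finset.prod_pos fun p hp => (Nat.prime_of_mem_primeFactors (Finset.mem_filter.mp hp).1).pos
  -- `n < N`
  have hnN : (n : ℝ) < N := by
    have h1 : (n : ℝ) = lowPartLT T k d * C := by rw [← hCn]; push_cast; ring
    have hL0 : (0 : ℝ) ≤ lowPartLT T k d := Nat.cast_nonneg _
    have hC0 : (0 : ℝ) ≤ C := Nat.cast_nonneg _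
    have hA0 : (0 : ℝ) < A := lt_of_lt_of_le one_pos hA
    calc (n : ℝ) = lowPartLT T k d * C := h1
      _ ≤ A * C := mul_le_mul_of_nonneg_right hLT hC0
      _ < A * Y := mul_lt_mul_of_pos_left hCY hA0
      _ ≤ N := hAY
  -- `m < M`
  have hmM : (m : ℝ) < M := by
    have hA0 : (0 : ℝ) < A := lt_of_lt_of_le one_pos hA
    have hnr : (0 : ℝ) < n := by exact_mod_cast hn0
    have h1 : (n : ℝ) * m = d := by exact_mod_cast hnm
    have h2 : (d : ℝ) ≤ Dn := by exact_mod_cast hdD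
    have h3 : (n : ℝ) * m ≤ A * M := by rw [h1]; exact h2.trans hDM
    have hM0 : (0 : ℝ) < M := by
      by_contra hcon
      have hM : (M : ℝ) ≤ 0 := not_lt.mp hcon
      have : A * (M : ℝ) ≤ 0 := mul_nonpos_of_nonneg_of_nonpos hA0.le hM
      have hd1 : (1 : ℝ) < d := lt_of_le_of_lt hA hdA
      nlinarith
    by_contra hcon
    have hmM' : (M : ℝ) ≤ m := not_lt.mp hcon
    have : A * (M : ℝ) < n * m := by
      calc A * (M : ℝ) < n * M := mul_lt_mul_of_pos_right hk hM0
        _ ≤ n * m := mul_le_mul_of_nonneg_left hmM' hnr.le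
    linarith
  refine ⟨k, hkK, n, ?_, m, ?_, hnm⟩
  · rw [mem_lowSet]
    refine ⟨⟨hn0, by exact_mod_cast hnN⟩, squarefree_lowPart T k hd, fun p hp => ?_, hk, ?_⟩
    · rw [hn, primeFactors_lowPart, Finset.mem_filter] at hp
      exact ⟨hdY p hp.1, hp.2⟩
    · rw [hn, lowPartLT_lowPart]; exact hLT
  · rw [mem_highSet]
    refine ⟨⟨hm0, by exact_mod_cast hmM⟩, hd.squarefree_of_dvd (Dvd.intro_left n hnm), fun p hp => ?_⟩
    rw [hm, Nat.primeFactors_prod (fun q hq => Nat.prime_of_mem_primeFactors (Finset.mem_filter.mp hq).1),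
      Finset.mem_filter] at hp
    exact ⟨hdY p hp.1, not_le.mp hp.2⟩

/-- **Uniqueness of the cell factorisation**: if `n · m = n' · m'` with `(n, m)` in the classes
of level `k` and `(n', m')` in those of level `k'`, then `k = k'`, `n = n'`, `m = m'`. [folklore] -/
theorem eq_of_mul_eq_mul {T A : ℝ} {Y N M k k' n n' m m' : ℕ}
    (hn : n ∈ lowSet T A Y N k) (hm : m ∈ highSet T Y M k)
    (hn' : n' ∈ lowSet T A Y N k') (hm' : m' ∈ highSet T Y M k') (h : n * m = n' * m') :
    k = k' ∧ n = n' ∧ m = m' := by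
  have key : ∀ {k₁ k₂ n₁ n₂ m₁ m₂ : ℕ}, n₁ ∈ lowSet T A Y N k₁ → m₁ ∈ highSet T Y M k₁ →
      n₂ ∈ lowSet T A Y N k₂ → m₂ ∈ highSet T Y M k₂ → n₁ * m₁ = n₂ * m₂ → ¬ k₁ < k₂ := by
    intro k₁ k₂ n₁ n₂ m₁ m₂ h₁ hm₁ h₂ hm₂ he hlt
    have hdvd : lowPart T k₁ (n₁ * m₁) ∣ lowPartLT T k₂ (n₁ * m₁) := lowPart_dvd_lowPartLT T hlt _
    rw [lowPart_mul_of_mem h₁ hm₁, he, lowPartLT_mul_of_mem h₂ hm₂] at hdvd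
    have hle : n₁ ≤ lowPartLT T k₂ n₂ := Nat.le_of_dvd (lowPartLT_pos T k₂ n₂) hdvd
    have ha := (mem_lowSet.mp h₁).2.2.2.1
    have hb := (mem_lowSet.mp h₂).2.2.2.2
    have hle' : (n₁ : ℝ) ≤ lowPartLT T k₂ n₂ := by exact_mod_cast hle
    linarith
  have hk : k = k' := by
    rcases lt_trichotomy k k' with hlt | heq | hgt
    · exact absurd hlt (key hn hm hn' hm' h)
    · exact heq
    · exact absurd hgt (key hn' hm' hn hm h.symm)
  subst hk
  have hnn : n = n' := by
    have h1 := lowPart_mul_of_mem hn hm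
    have h2 := lowPart_mul_of_mem hn' hm'
    rw [h] at h1
    exact h1.symm.trans h2
  subst hnn
  have hn0 : 0 < n := (mem_lowSet.mp hn).1.1
  exact ⟨rfl, rfl, Nat.eq_of_mul_eq_mul_left hn0 h⟩

/-! ### The class partition of a sum over squarefree friable numbers -/

section partition

variable {T A : ℝ} {Y N M Dn K : ℕ}

/-- The index set of the class decomposition: triples `(k, n, m)` with `k ≤ K`, `n ∈ lowSet k`,
`m ∈ highSet k`, `n · m ≤ Dn`. [folklore] -/
def triples (T A : ℝ) (Y N M Dn K : ℕ) : Finset (Σ _ : ℕ, Σ _ : ℕ, ℕ) :=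
  (Finset.range (K + 1)).sigma fun k => (lowSet T A Y N k).sigma fun n =>
    (highSet T Y M k).filter (fun m => n * m ≤ Dn)

/-- Membership in `triples`. [folklore] -/
theorem mem_triples {t : Σ _ : ℕ, Σ _ : ℕ, ℕ} :
    t ∈ triples T A Y N M Dn K ↔ t.1 < K + 1 ∧ t.2.1 ∈ lowSet T A Y N t.1 ∧
      t.2.2 ∈ highSet T Y M t.1 ∧ t.2.1 * t.2.2 ≤ Dn := by
  rcases t with ⟨k, n, m⟩
  simp only [triples, Finset.mem_sigma, Finset.mem_range, Finset.mem_filter]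

/-- Sums over `triples` are the iterated class sums. [folklore] -/
theorem sum_triples (G : ℕ → ℝ) :
    ∑ t ∈ triples T A Y N M Dn K, G (t.2.1 * t.2.2) =
      ∑ k ∈ Finset.range (K + 1), ∑ n ∈ lowSet T A Y N k,
        ∑ m ∈ (highSet T Y M k).filter (fun m => n * m ≤ Dn), G (n * m) := by
  unfold triples
  rw [Finset.sum_sigma]
  refine Finset.sum_congr rfl fun k _ => ?_
  rw [Finset.sum_sigma]

/-- The product map is injective on `triples`. [folklore] -/
theorem injOn_triples :
    Set.InjOn (fun t : Σ _ : ℕ, Σ _ : ℕ, ℕ => t.2.1 * t.2.2) ↑(triples T A Y N M Dn K) := by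
  rintro ⟨k, n, m⟩ ht ⟨k', n', m'⟩ ht' h
  have h1 := mem_triples.mp (Finset.mem_coe.mp ht)
  have h2 := mem_triples.mp (Finset.mem_coe.mp ht')
  obtain ⟨hk, hn, hm⟩ := eq_of_mul_eq_mul h1.2.1 h1.2.2.1 h2.2.1 h2.2.2.1 h
  subst hk; subst hn; subst hm
  rfl

/-- The image of `triples` under the product map consists of squarefree `Y`-friable numbers
`≤ Dn`. [folklore] -/
theorem image_triples_subset :
    (triples T A Y N M Dn K).image (fun t => t.2.1 * t.2.2) ⊆
      (Nat.smoothNumbersUpTo Dn Y).filter Squarefree := by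
  intro d hd
  obtain ⟨⟨k, n, m⟩, ht, rfl⟩ := Finset.mem_image.mp hd
  have h := mem_triples.mp ht
  rw [Finset.mem_filter, Nat.mem_smoothNumbersUpTo]
  exact ⟨⟨h.2.2.2, mul_mem_smoothNumbers h.2.1 h.2.2.1⟩, squarefree_mul_of_mem h.2.1 h.2.2.1⟩

/-- Squarefree friable numbers missed by the class decomposition are `≤ A` or have two distinct
prime factors in one cell. [folklore] -/
theorem mem_image_triples (hA : 1 ≤ A) (hAY : A * Y ≤ N) (hDM : (Dn : ℝ) ≤ A * M)
    (hK : ∀ p, p < Y → cell T p ≤ K) {d : ℕ}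
    (hd : d ∈ (Nat.smoothNumbersUpTo Dn Y).filter Squarefree) (hdA : A < (d : ℝ))
    (hsep : ∀ q ∈ d.primeFactors, ∀ q' ∈ d.primeFactors, cell T q = cell T q' → q = q') :
    d ∈ (triples T A Y N M Dn K).image (fun t => t.2.1 * t.2.2) := by
  rw [Finset.mem_filter, Nat.mem_smoothNumbersUpTo] at hd
  have hdY : ∀ p ∈ d.primeFactors, p < Y := fun p hp =>
    (Nat.mem_smoothNumbers'.mp hd.1.2) p (Nat.prime_of_mem_primeFactors hp) (Nat.dvd_of_mem_primeFactors hp)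
  obtain ⟨k, hkK, n, hn, m, hm, hnm⟩ := exists_factorisation hA hAY hDM hd.2 hdY
    (fun p hp => hK p (hdY p hp)) hdA hd.1.1 hsep
  refine Finset.mem_image.mpr ⟨⟨k, n, m⟩, ?_, hnm⟩
  exact mem_triples.mpr ⟨Nat.lt_succ_of_le hkK, hn, hm, hnm.le.trans_eq rfl |>.trans hd.1.1⟩

/-- **The class partition, inequality form.**  For any `F : ℕ → ℝ`, the sum of `F` over the
squarefree `Y`-friable `d ≤ Dn` differs from the iterated class sum
`∑_{k ≤ K} ∑_{n ∈ lowSet k} ∑_{m ∈ highSet k, nm ≤ Dn} F(nm)` by at most the sum of `|F|` over the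
`d ≤ A` plus the sum of `|F|` over the `d` with two distinct prime factors in one cell. [folklore] -/
theorem abs_sum_sub_sum_classes_le (hA : 1 ≤ A) (hAY : A * Y ≤ N) (hDM : (Dn : ℝ) ≤ A * M)
    (hK : ∀ p, p < Y → cell T p ≤ K) (F : ℕ → ℝ) :
    |∑ d ∈ (Nat.smoothNumbersUpTo Dn Y).filter Squarefree, F d -
      ∑ k ∈ Finset.range (K + 1), ∑ n ∈ lowSet T A Y N k,
        ∑ m ∈ (highSet T Y M k).filter (fun m => n * m ≤ Dn), F (n * m)| ≤
    ∑ d ∈ ((Nat.smoothNumbersUpTo Dn Y).filter Squarefree).filter (fun d : ℕ => (d : ℝ) ≤ A), |F d| +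
    ∑ d ∈ ((Nat.smoothNumbersUpTo Dn Y).filter Squarefree).filter
        (fun d => ∃ q ∈ d.primeFactors, ∃ q' ∈ d.primeFactors, q ≠ q' ∧ cell T q = cell T q'), |F d| := by
  classical
  set S := (Nat.smoothNumbersUpTo Dn Y).filter Squarefree with hS
  set P := triples T A Y N M Dn K with hP
  set Im := P.image (fun t => t.2.1 * t.2.2) with hIm
  have hsub : Im ⊆ S := image_triples_subset
  have hclasses : ∑ k ∈ Finset.range (K + 1), ∑ n ∈ lowSet T A Y N k,
      ∑ m ∈ (highSet T Y M k).filter (fun m => n * m ≤ Dn), F (n * m) = ∑ d ∈ Im, F d := by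
    rw [← sum_triples, hIm, Finset.sum_image injOn_triples]
  have hsplit : ∑ d ∈ S, F d = ∑ d ∈ Im, F d + ∑ d ∈ S \ Im, F d := by
    rw [← Finset.sum_union (Finset.disjoint_sdiff), Finset.union_sdiff_of_subset hsub]
  rw [hclasses, hsplit, add_sub_cancel_left]
  -- the missed `d`
  set Small := S.filter (fun d : ℕ => (d : ℝ) ≤ A) with hSmall
  set Bad := S.filter
    (fun d => ∃ q ∈ d.primeFactors, ∃ q' ∈ d.primeFactors, q ≠ q' ∧ cell T q = cell T q') with hBad
  have hmiss : S \ Im ⊆ Small ∪ Bad := by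
    intro d hd
    rw [Finset.mem_sdiff] at hd
    rw [Finset.mem_union]
    by_contra hcon
    push Not at hcon
    have h1 : A < (d : ℝ) := by
      by_contra h; exact hcon.1 (Finset.mem_filter.mpr ⟨hd.1, not_lt.mp h⟩)
    have h2 : ∀ q ∈ d.primeFactors, ∀ q' ∈ d.primeFactors, cell T q = cell T q' → q = q' := by
      intro q hq q' hq' hc
      by_contra hne
      exact hcon.2 (Finset.mem_filter.mpr ⟨hd.1, q, hq, q', hq', hne, hc⟩)
    exact hd.2 (mem_image_triples hA hAY hDM hK hd.1 h1 h2)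
  calc |∑ d ∈ S \ Im, F d| ≤ ∑ d ∈ S \ Im, |F d| := Finset.abs_sum_le_sum_abs _ _
    _ ≤ ∑ d ∈ Small ∪ Bad, |F d| :=
        Finset.sum_le_sum_of_subset_of_nonneg hmiss fun _ _ _ => abs_nonneg _
    _ ≤ ∑ d ∈ Small, |F d| + ∑ d ∈ Bad, |F d| := by
        rw [← Finset.sum_union_inter]
        exact le_add_of_nonneg_right (Finset.sum_nonneg fun _ _ => abs_nonneg _)

/-- **Sub-sums of the class decomposition are dominated by sums over `d`**: for `G ≥ 0` and any
predicate `Q`, `∑_{k ≤ K} ∑_{n ∈ lowSet k} ∑_{m ∈ highSet k, nm ≤ Dn, Q(nm)} G(nm) ≤ ∑_{d, Q d} G(d)`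
over the squarefree `Y`-friable `d ≤ Dn`. [folklore] -/
theorem sum_classes_filter_le (G : ℕ → ℝ) (hG : ∀ d, 0 ≤ G d) (Q : ℕ → Prop) [DecidablePred Q] :
    ∑ k ∈ Finset.range (K + 1), ∑ n ∈ lowSet T A Y N k,
        ∑ m ∈ (highSet T Y M k).filter (fun m => n * m ≤ Dn ∧ Q (n * m)), G (n * m) ≤
      ∑ d ∈ ((Nat.smoothNumbersUpTo Dn Y).filter Squarefree).filter Q, G d := by
  classical
  set P := (triples T A Y N M Dn K).filter (fun t => Q (t.2.1 * t.2.2)) with hP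
  have hlhs : ∑ k ∈ Finset.range (K + 1), ∑ n ∈ lowSet T A Y N k,
      ∑ m ∈ (highSet T Y M k).filter (fun m => n * m ≤ Dn ∧ Q (n * m)), G (n * m) =
      ∑ t ∈ P, G (t.2.1 * t.2.2) := by
    rw [hP, triples, Finset.filter_sigma, Finset.sum_sigma]
    refine Finset.sum_congr rfl fun k _ => ?_
    rw [Finset.filter_sigma, Finset.sum_sigma]
    refine Finset.sum_congr rfl fun n _ => ?_
    rw [Finset.filter_filter]
  have hinj : Set.InjOn (fun t : Σ _ : ℕ, Σ _ : ℕ, ℕ => t.2.1 * t.2.2) ↑P :=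
    injOn_triples.mono (Finset.coe_subset.mpr (Finset.filter_subset _ _))
  rw [hlhs, ← Finset.sum_image hinj]
  refine Finset.sum_le_sum_of_subset_of_nonneg (fun d hd => ?_) fun _ _ _ => hG _
  obtain ⟨t, ht, rfl⟩ := Finset.mem_image.mp hd
  rw [hP, Finset.mem_filter] at ht
  rw [Finset.mem_filter]
  exact ⟨image_triples_subset (Finset.mem_image_of_mem _ ht.1), ht.2⟩

end partition

end Literature.NumberTheory.Sieve.FriableCell

end
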